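import Summits.HodgeConjecture.HodgeConjecture.Theorems.CurveNetMordellWeilVerticalSupportMiddleChowDegenerate
import Summits.HodgeConjecture.HodgeConjecture.Theorems.CurveNetMordellWeilVerticalSupportMiddleIffHodge
import Literature.AlgebraicGeometry.HodgeTheory.TopHodgeClassesSpannedByPullbacksHolds

/-!
# Route CurveNetMordellWeil — `VerticalSupportMiddle`: the level × CH₀ split and its glue

The crux `VerticalSupportMiddle` (stmt-HodgeConjecture-2782) is, as typed, the Hodge conjecture
(`verticalSupportMiddle_iff_hodgeConjecture`). The crux-strategist's typed decomposition
(`Cruxes/VerticalSupportMiddle/Lines/level_regime_split.lean`, `SPLIT-PACKAGE.md`, 2026-08-17) cuts it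
into three pieces — HC(4;2,2) for CH₀-degenerate fourfolds (P₁), HC(4;2,2) for CH₀-non-degenerate
fourfolds (P₂, the fourfold heart), and the summit granted HC(4;2,2) (P₃, verbatim the shared crux
`NoetherLefschetzOneUp.SummitGrantedFourfolds`). This prover-side file lands the GLUE of that split
(sorry-free, over landed theorems), so that the route edit can cite it (`--glue-by`):

* `verticalSupportMiddle_of_fourfoldRegimes_of_granted` — P₁ → P₂ → P₃ → `VerticalSupportMiddle`, with
  the CH₀-hypothesis written `RegimeSplit.ChowZeroDegenerate X`;
* `verticalSupportMiddle_of_fourfoldRegimes_of_granted_unfolded` — the same with every piece statement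
  written out verbatim (the exact type of the route's glue item after the split; the CH₀-hypothesis
  inlined is `ChowZeroDegenerate X` by `Iff.rfl`);
* `hodgeFourfoldsChowDegenerate_of_degreeFormula` — P₁ from Fulton's degree formula for the complex
  orientations ALONE (the spanning fact `topHodgeClasses_spanned_by_pullbacks` being a theorem of the
  tree since p145587, lead c2 of the line `regime-split-middle-step`).

## References

* [Deligne2000] P. Deligne, The Hodge conjecture (Clay problem description), §1.
* [VoisinHodgeII2003] C. Voisin, Hodge Theory and Complex Algebraic Geometry II, Cor. 10.21, Thm. 10.17,
  Prop. 10.26.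
* [ConteMurre1978] A. Conte, J. P. Murre, The Hodge conjecture for fourfolds admitting a covering by
  rational curves, Math. Ann. 238 (1978).
* [Fulton1998] W. Fulton, Intersection Theory, 2nd ed., Lemma 19.1.2.
-/

noncomputable section

-- `Summit.HodgeConjecture.HodgeConjecture.Theorems` is the mandated namespace (single-problem summit),
-- flagged by `linter.dupNamespace`; the lakefile turns the linter off tree-wide, restated for stand-alone runs.
set_option linter.dupNamespace false

open CategoryTheory AlgebraicGeometry
open Literature.AlgebraicGeometry Literature.AlgebraicGeometry.Motives Literature.AlgebraicGeometry.HodgeTheory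
open Summit.HodgeConjecture.HodgeConjecture.Theorems.RegimeSplit

namespace Summit.HodgeConjecture.HodgeConjecture.Theorems

/-- **The glue of the level × CH₀ split of `VerticalSupportMiddle`.** HC(4;2,2) for CH₀-degenerate
fourfolds, HC(4;2,2) for CH₀-non-degenerate fourfolds, and "HC(4;2,2) ⟹ the Hodge conjecture in every
dimension" together give the crux: HC(4;2,2) by the case split on `ChowZeroDegenerate`, the summit by the
third piece, the crux by `verticalSupportMiddle_of_hodgeConjecture`. [cite: Deligne2000, §1]
[cite: VoisinHodgeII2003, Cor. 10.21 and Thm. 10.17] -/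
theorem verticalSupportMiddle_of_fourfoldRegimes_of_granted
    (h₁ : ∀ ⦃X : SchemeOver ℂ⦄, IsSmoothProjective 4 X → ChowZeroDegenerate X →
      ∀ c : complexBetti X (2 * 2), IsRationalClass c → IsOfHodgeType 4 X (2 * 2) 2 2 c → c ∈ algebraicClasses X 2)
    (h₂ : ∀ ⦃X : SchemeOver ℂ⦄, IsSmoothProjective 4 X → ¬ ChowZeroDegenerate X →
      ∀ c : complexBetti X (2 * 2), IsRationalClass c → IsOfHodgeType 4 X (2 * 2) 2 2 c → c ∈ algebraicClasses X 2)
    (h₃ : (∀ ⦃X : SchemeOver ℂ⦄, IsSmoothProjective 4 X → ∀ c : complexBetti X (2 * 2), IsRationalClass c →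
        IsOfHodgeType 4 X (2 * 2) 2 2 c → c ∈ algebraicClasses X 2) → _root_.HodgeConjecture) :
    Summit.HodgeConjecture.HodgeConjecture.Theses.CurveNetMordellWeil.VerticalSupportMiddle := by
  refine verticalSupportMiddle_of_hodgeConjecture (h₃ fun Y hY c hc hh ↦ ?_)
  by_cases hW : ChowZeroDegenerate Y
  · exact h₁ hY hW c hc hh
  · exact h₂ hY hW c hc hh

/-- **The same glue with every piece statement written out** (the exact hypotheses of the route's glue item
after `route edit --split VerticalSupportMiddle`: P₁ `HodgeFourfoldsChowDegenerate`, P₂ `HodgeFourfoldsHeart`,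
P₃ `SummitGrantedFourfolds`, the CH₀-hypothesis inlined; conclusion the route decl by name).
[cite: Deligne2000, §1] [cite: VoisinHodgeII2003, Cor. 10.21 and Thm. 10.17] -/
theorem verticalSupportMiddle_of_fourfoldRegimes_of_granted_unfolded :
    (∀ ⦃X : Literature.AlgebraicGeometry.Motives.SchemeOver ℂ⦄, Literature.AlgebraicGeometry.Motives.IsSmoothProjective 4 X → (∃ W : Set X.left, IsClosed W ∧ W ≠ Set.univ ∧ ∀ z ∈ Literature.AlgebraicGeometry.Motives.cyclesOfDim X.left 0, ∃ z' ∈ Literature.AlgebraicGeometry.Motives.cyclesOfDim X.left 0, (∀ x, z' x ≠ 0 → x ∈ W) ∧ Literature.AlgebraicGeometry.Motives.IsRationallyEquivalent z z' 0) → ∀ c : Literature.AlgebraicGeometry.HodgeTheory.complexBetti X (2 * 2), Literature.AlgebraicGeometry.HodgeTheory.IsRationalClass c → Literature.AlgebraicGeometry.HodgeTheory.IsOfHodgeType 4 X (2 * 2) 2 2 c → c ∈ Literature.AlgebraicGeometry.HodgeTheory.algebraicClasses X 2) →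
    (∀ ⦃X : Literature.AlgebraicGeometry.Motives.SchemeOver ℂ⦄, Literature.AlgebraicGeometry.Motives.IsSmoothProjective 4 X → ¬ (∃ W : Set X.left, IsClosed W ∧ W ≠ Set.univ ∧ ∀ z ∈ Literature.AlgebraicGeometry.Motives.cyclesOfDim X.left 0, ∃ z' ∈ Literature.AlgebraicGeometry.Motives.cyclesOfDim X.left 0, (∀ x, z' x ≠ 0 → x ∈ W) ∧ Literature.AlgebraicGeometry.Motives.IsRationallyEquivalent z z' 0) → ∀ c : Literature.AlgebraicGeometry.HodgeTheory.complexBetti X (2 * 2), Literature.AlgebraicGeometry.HodgeTheory.IsRationalClass c → Literature.AlgebraicGeometry.HodgeTheory.IsOfHodgeType 4 X (2 * 2) 2 2 c → c ∈ Literature.AlgebraicGeometry.HodgeTheory.algebraicClasses X 2) →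
    ((∀ ⦃X : Literature.AlgebraicGeometry.Motives.SchemeOver ℂ⦄, Literature.AlgebraicGeometry.Motives.IsSmoothProjective 4 X → ∀ c : Literature.AlgebraicGeometry.HodgeTheory.complexBetti X (2 * 2), Literature.AlgebraicGeometry.HodgeTheory.IsRationalClass c → Literature.AlgebraicGeometry.HodgeTheory.IsOfHodgeType 4 X (2 * 2) 2 2 c → c ∈ Literature.AlgebraicGeometry.HodgeTheory.algebraicClasses X 2) → ∀ ⦃n : ℕ⦄ ⦃X : Literature.AlgebraicGeometry.Motives.SchemeOver ℂ⦄, Literature.AlgebraicGeometry.Motives.IsSmoothProjective n X → Nonempty (Literature.AlgebraicGeometry.HodgeTheory.HodgeModel n X) ∧ ∀ (p : ℕ) (c : Literature.AlgebraicGeometry.HodgeTheory.complexBetti X (2 * p)), Literature.AlgebraicGeometry.HodgeTheory.IsRationalClass c → Literature.AlgebraicGeometry.HodgeTheory.IsOfHodgeType n X (2 * p) p p c → c ∈ Literature.AlgebraicGeometry.HodgeTheory.algebraicClasses X p) →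
    Summit.HodgeConjecture.HodgeConjecture.Theses.CurveNetMordellWeil.VerticalSupportMiddle :=
  fun h₁ h₂ h₃ ↦ verticalSupportMiddle_of_fourfoldRegimes_of_granted (fun _ hX hW ↦ h₁ hX hW)
    (fun _ hX hW ↦ h₂ hX hW) (fun h42 _ _ hX ↦ h₃ h42 hX)

/-- **Piece P₁ (HC(4;2,2) for CH₀-degenerate fourfolds) from the degree formula alone**: the spanning fact
`topHodgeClasses_spanned_by_pullbacks` is a theorem of the tree (`topHodgeClasses_spanned_by_pullbacks_holds`), so
the CH₀-degenerate regime `middleStepChowDegenerate_of_degreeFormula_of_spanning` at `q = 2` needs only Fulton's degree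
formula for the complex orientations (and the induction hypothesis `hodgeBelowDim_four`, a theorem).
[cite: ConteMurre1978] [cite: VoisinHodgeII2003, Prop. 10.26] [cite: Fulton1998, Lemma 19.1.2] -/
theorem hodgeFourfoldsChowDegenerate_of_degreeFormula (hB : Fulton1998_degreeFormula_complexOrientation) :
    ∀ ⦃X : SchemeOver ℂ⦄, IsSmoothProjective 4 X → ChowZeroDegenerate X →
      ∀ c : complexBetti X (2 * 2), IsRationalClass c → IsOfHodgeType 4 X (2 * 2) 2 2 c → c ∈ algebraicClasses X 2 :=
  fun _ hX hW c hc hh ↦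
    middleStepChowDegenerate_of_degreeFormula_of_spanning hB topHodgeClasses_spanned_by_pullbacks_holds le_rfl hX
      hodgeBelowDim_four hW c hc hh

end Summit.HodgeConjecture.HodgeConjecture.Theorems

end
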